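import Summits.Ventures.WeilGRH.TwistedGramCellCheckH
import Summits.Ventures.WeilGRH.TwistedGramCellCheckOdd
import HarnessLib

/-!
# GRH arm (rh-explicit, venture WeilGRH): ROW-SPLIT cell checkers for the twisted format-C χ-cells

Cell `rh-explicit`, WEIL TRACK — GRH ARM (engine seat weil-grh-2 gen10).  The cell checkers `checkCellH`
(`TwistedGramCellCheckH.lean`, door H even sector) and `checkCellO` (`TwistedGramCellCheckOdd.lean`, odd sector) evaluate
ALL `B × B` entries of a cell (each a Schur complement over `B₃ − B` far columns) in ONE `decide +kernel`; for the razor cell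
`(−3/·)` at `log 2` (blocks `12 × 96 ∣ 16 × 96`) that single evaluation exceeds the kernel's memory budget.  This file splits the
work by ROWS without touching the mathematics: `checkCellHHead` / `checkCellOHead` are the (cheap) header conjuncts,
`checkCellHRows … i₀ n` / `checkCellORows … i₀ n` check the rows `i₀ ≤ i < i₀ + n` only (glued by `checkCellHRows_append` /
`checkCellORows_append`), and `checkCellH_of_rows` / `checkCellO_of_rows` reassemble the ORIGINAL `checkCellH = true` /
`checkCellO = true` from the header and a row range `[0, n)`, `n ≥ B` —
so the soundness theorems `hSe_of_checkCellH` / `hSo_of_checkCellO` apply verbatim.  Pure Boolean bookkeeping; RH/GRH-free;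
standard axioms.  Reference for the enclosure semantics: R. E. Moore (1966) Ch. 3 [Moore1966].
-/

set_option linter.style.longLine false

namespace Summit.Ventures.WeilGRH

namespace TwistedEncl
open Literature.NumberTheory.LFunctions Literature.NumberTheory.LFunctions.Yoshida1992 Encl
open Literature.Analysis.ValidatedNumerics.NumericsMP

variable {S : ℕ}

/-! ## Even sector (door H) -/

/-- The header conjuncts of `checkCellH` (block shape, positivity of the data, `P.lo > 0`, far weights positive).
[cite: Moore1966, Ch. 3 (interval arithmetic: inclusion property)] -/
def checkCellHHead (P : MI) (d : EvenCellData) (e : HCellExtra) : Bool :=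
  decide (2 ≤ d.B) && decide (2 * d.B ≤ d.B3) && decide (0 < d.θN) && decide (0 < d.θD) && decide (0 < d.d0N) &&
    decide (0 < e.θpN) && decide (0 < e.θpD) && decide (0 < P.lo) &&
    (List.range (d.B3 - d.B)).all (fun c' ↦ decide (0 < d.wN.getD c' 0))

/-- The rows `i₀ ≤ i < i₀ + n` of the cell check `checkCellH` (entry enclosures only).
[cite: Moore1966, Ch. 3 (interval arithmetic: inclusion property)] -/
def checkCellHRows (S : ℕ) (C : Consts) (εs : List ℤ) (LQ : MI) (tab : List IdxRec) (P : MI) (stab dtab : List MI)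
    (d : EvenCellData) (e : HCellExtra) (c : ℕ) (ρ : ℤ) (D : List (List ℤ)) (i0 n : ℕ) : Bool :=
  (List.range' i0 n).all fun i ↦ (List.range d.B).all fun j ↦
    enclCheck S c ρ (PsdDyadic.getMZ D i j) (cellH S C εs LQ tab P stab dtab d e i j)

/-- Semantics of a row range. [cite: Moore1966, Ch. 3 (interval arithmetic: inclusion property)] -/
theorem checkCellHRows_iff {C : Consts} {εs : List ℤ} {LQ : MI} {tab : List IdxRec} {P : MI} {stab dtab : List MI}
    {d : EvenCellData} {e : HCellExtra} {c : ℕ} {ρ : ℤ} {D : List (List ℤ)} {i0 n : ℕ} :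
    checkCellHRows S C εs LQ tab P stab dtab d e c ρ D i0 n = true ↔
      ∀ i, i0 ≤ i → i < i0 + n → ∀ j < d.B, enclCheck S c ρ (PsdDyadic.getMZ D i j) (cellH S C εs LQ tab P stab dtab d e i j) = true := by
  unfold checkCellHRows
  simp only [List.all_eq_true, List.mem_range'_1, List.mem_range, and_imp]

/-- Consecutive row ranges glue. [cite: Moore1966, Ch. 3 (interval arithmetic: inclusion property)] -/
theorem checkCellHRows_append {C : Consts} {εs : List ℤ} {LQ : MI} {tab : List IdxRec} {P : MI} {stab dtab : List MI}
    {d : EvenCellData} {e : HCellExtra} {c : ℕ} {ρ : ℤ} {D : List (List ℤ)} {i0 n1 n2 : ℕ}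
    (h1 : checkCellHRows S C εs LQ tab P stab dtab d e c ρ D i0 n1 = true)
    (h2 : checkCellHRows S C εs LQ tab P stab dtab d e c ρ D (i0 + n1) n2 = true) :
    checkCellHRows S C εs LQ tab P stab dtab d e c ρ D i0 (n1 + n2) = true := by
  rw [checkCellHRows_iff] at h1 h2 ⊢
  intro i hi1 hi2 j hj
  by_cases h : i < i0 + n1
  · exact h1 i hi1 h j hj
  · exact h2 i (by omega) (by omega) j hj

/-- Consecutive row ranges glue — all indices literal (no index arithmetic left to unification). [folklore] -/
theorem checkCellHRows_glue {C : Consts} {εs : List ℤ} {LQ : MI} {tab : List IdxRec} {P : MI} {stab dtab : List MI}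
    {d : EvenCellData} {e : HCellExtra} {c : ℕ} {ρ : ℤ} {D : List (List ℤ)} {i0 n1 i1 n2 n : ℕ}
    (h1 : checkCellHRows S C εs LQ tab P stab dtab d e c ρ D i0 n1 = true)
    (h2 : checkCellHRows S C εs LQ tab P stab dtab d e c ρ D i1 n2 = true) (hi : i1 = i0 + n1) (hn : n = n1 + n2) :
    checkCellHRows S C εs LQ tab P stab dtab d e c ρ D i0 n = true := by
  subst hi hn; exact checkCellHRows_append h1 h2

/-- ★ Reassembly: the header and the full row range `[0, B)` give back `checkCellH = true` (so `hSe_of_checkCellH` applies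
verbatim). [cite: Moore1966, Ch. 3 (interval arithmetic: inclusion property)] -/
theorem checkCellH_of_rows {C : Consts} {εs : List ℤ} {LQ : MI} {tab : List IdxRec} {P : MI} {stab dtab : List MI}
    {d : EvenCellData} {e : HCellExtra} {c : ℕ} {ρ : ℤ} {D : List (List ℤ)}
    {n : ℕ} (hh : checkCellHHead P d e = true) (hr : checkCellHRows S C εs LQ tab P stab dtab d e c ρ D 0 n = true)
    (hn : d.B ≤ n) : checkCellH S C εs LQ tab P stab dtab d e c ρ D = true := by
  rw [checkCellHRows_iff] at hr
  unfold checkCellHHead at hh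
  unfold checkCellH
  simp only [Bool.and_eq_true, decide_eq_true_eq, List.all_eq_true, List.mem_range] at hh ⊢
  exact ⟨hh, fun i hi j hj ↦ hr i (Nat.zero_le i) (by omega) j hj⟩

/-! ## Odd sector -/

/-- The header conjuncts of `checkCellO`. [cite: Moore1966, Ch. 3 (interval arithmetic: inclusion property)] -/
def checkCellOHead (d : OddCellData) : Bool :=
  decide (1 ≤ d.B) && decide (2 * d.B ≤ d.B3) && decide (0 < d.θN) && decide (0 < d.θD) && decide (0 < d.d0N) &&
    (List.range (d.B3 - d.B)).all (fun c' ↦ decide (0 < d.wN.getD c' 0))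

/-- The rows `k₀ ≤ k < k₀ + n` of the cell check `checkCellO` (entry enclosures only).
[cite: Moore1966, Ch. 3 (interval arithmetic: inclusion property)] -/
def checkCellORows (S : ℕ) (C : Consts) (εs : List ℤ) (LQ : MI) (tab : List IdxRec) (d : OddCellData) (c : ℕ) (ρ : ℤ)
    (D : List (List ℤ)) (k0 n : ℕ) : Bool :=
  (List.range' k0 n).all fun k ↦ (List.range d.B).all fun k' ↦
    enclCheck S c ρ (PsdDyadic.getMZ D k k') (cellO S C εs LQ tab d k k')

/-- Semantics of a row range. [cite: Moore1966, Ch. 3 (interval arithmetic: inclusion property)] -/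
theorem checkCellORows_iff {C : Consts} {εs : List ℤ} {LQ : MI} {tab : List IdxRec} {d : OddCellData} {c : ℕ} {ρ : ℤ}
    {D : List (List ℤ)} {k0 n : ℕ} :
    checkCellORows S C εs LQ tab d c ρ D k0 n = true ↔
      ∀ k, k0 ≤ k → k < k0 + n → ∀ k' < d.B, enclCheck S c ρ (PsdDyadic.getMZ D k k') (cellO S C εs LQ tab d k k') = true := by
  unfold checkCellORows
  simp only [List.all_eq_true, List.mem_range'_1, List.mem_range, and_imp]

/-- Consecutive row ranges glue. [cite: Moore1966, Ch. 3 (interval arithmetic: inclusion property)] -/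
theorem checkCellORows_append {C : Consts} {εs : List ℤ} {LQ : MI} {tab : List IdxRec} {d : OddCellData} {c : ℕ} {ρ : ℤ}
    {D : List (List ℤ)} {k0 n1 n2 : ℕ} (h1 : checkCellORows S C εs LQ tab d c ρ D k0 n1 = true)
    (h2 : checkCellORows S C εs LQ tab d c ρ D (k0 + n1) n2 = true) :
    checkCellORows S C εs LQ tab d c ρ D k0 (n1 + n2) = true := by
  rw [checkCellORows_iff] at h1 h2 ⊢
  intro k hk1 hk2 k' hk'
  by_cases h : k < k0 + n1
  · exact h1 k hk1 h k' hk'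
  · exact h2 k (by omega) (by omega) k' hk'

/-- Consecutive row ranges glue — all indices literal. [folklore] -/
theorem checkCellORows_glue {C : Consts} {εs : List ℤ} {LQ : MI} {tab : List IdxRec} {d : OddCellData} {c : ℕ} {ρ : ℤ}
    {D : List (List ℤ)} {k0 n1 k1 n2 n : ℕ} (h1 : checkCellORows S C εs LQ tab d c ρ D k0 n1 = true)
    (h2 : checkCellORows S C εs LQ tab d c ρ D k1 n2 = true) (hk : k1 = k0 + n1) (hn : n = n1 + n2) :
    checkCellORows S C εs LQ tab d c ρ D k0 n = true := by
  subst hk hn; exact checkCellORows_append h1 h2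

/-- ★ Reassembly: the header and the full row range `[0, B)` give back `checkCellO = true` (so `hSo_of_checkCellO` applies
verbatim). [cite: Moore1966, Ch. 3 (interval arithmetic: inclusion property)] -/
theorem checkCellO_of_rows {C : Consts} {εs : List ℤ} {LQ : MI} {tab : List IdxRec} {d : OddCellData} {c : ℕ} {ρ : ℤ}
    {D : List (List ℤ)} {n : ℕ} (hh : checkCellOHead d = true) (hr : checkCellORows S C εs LQ tab d c ρ D 0 n = true)
    (hn : d.B ≤ n) : checkCellO S C εs LQ tab d c ρ D = true := by
  rw [checkCellORows_iff] at hr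
  unfold checkCellOHead at hh
  unfold checkCellO
  simp only [Bool.and_eq_true, decide_eq_true_eq, List.all_eq_true, List.mem_range] at hh ⊢
  exact ⟨hh, fun k hk k' hk' ↦ hr k (Nat.zero_le k) (by omega) k' hk'⟩

end TwistedEncl

end Summit.Ventures.WeilGRH
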